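import Mathlib
import Summits.Ventures.PercRepro2.PMK5Deg5LocusCoverB
import Summits.Ventures.PercRepro2.PMK5Deg5LocusFaces1
import Summits.Ventures.PercRepro2.PMK5Deg5LocusFaces2
import Summits.Ventures.PercRepro2.PMK5Deg5LocusFaces3
import Summits.Ventures.PercRepro2.PMK5Deg5LocusFaces4
import Summits.Ventures.PercRepro2.PMK5Deg5LocusFaces5
import Summits.Ventures.PercRepro2.PMK5Deg5LocusFaces6

/-!
# THEOREM 31: THE EQUALITY LOCUS OF (HCOV) ON EVERY SIX-VERTEX MARKED GRAPH, BOTH DIRECTIONS, EVERY WEIGHT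
VECTOR — THE LEAD'S FIVE CLASSES IN THE KERNEL ON ALL `2^15` EDGE SETS OF `K₆`
(blind cell PercRepro2, mine-2 g32; the lens «equality locus first» closed one rung above Theorems 24 / 25:
on Theorem 30's certificate (`PMK5Deg5K6`), the Bernstein form `gc15_eq_bern`, the fifty witnesses
(`PMK5Deg5LocusWit`), the down-set property and the two coverings (`PMK5Deg5LocusCoverA/B`), the centre
factorisation (`PMK5Deg5LocusCnt`) and the fourteen maximal faces (`PMK5Deg5LocusFaces1–6`))

`K₆` with the marks `(o, a₁, a₂, a₃, b) = (0, 1, 2, 5, 4)` and the unmarked vertex `u = 3`, an edge set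
`M < 2^15` (edge order of `PMK5Deg5Kernel.lean`); a missing edge is an edge of weight `0`, so the faces of the
cube `[0,1]^15` are ALL six-vertex marked graphs with every weight vector.

* **`gc15_pos_of_face`**: `M` outside the five classes ⟹ `Gc p ends15 0 1 2 5 4 > 0` at every weight vector
  interior on `M`; **`gc15_zero_of_face`**: `M` in one of the five classes ⟹ `Gc p ends15 0 1 2 5 4 = 0` at
  every weight vector supported on `M`.
* **`gc15_pos_iff`** / **`gc15_zero_iff`**: the two «iff»s — (HCOV) is strict in the interior of a face ⟺ the
  graph is in none of the five classes; (HCOV) is an identity on a face ⟺ the graph is in one of them.  The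
  lead's Theorem 8.1 (LEAD-SEP3.md) on every six-vertex marked graph, in the kernel, both directions.
* **`gc15_pos`**: (HCOV) is strict on the open cube of `K₆`.
Standard axioms.
-/

namespace Summit.Ventures.PercRepro2

open Hub CovForm

namespace Deg5

namespace Locus

section Theorem31

variable {R : Type*} [Field R] [LinearOrder R] [IsStrictOrderedRing R]

/-- **`Gc` vanishes at the centre of each of the fourteen maximal degenerate faces.** -/
theorem gc_centre_MX (j : Fin 14) : Gc (centre (R := R) (MX j)) ends15 0 1 2 5 4 = 0 := by
  fin_cases j
  exacts [gc15_centre_zero 8179 zero_8179, gc15_centre_zero 15863 zero_15863,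
    gc15_centre_zero 19705 zero_19705, gc15_centre_zero 21946 zero_21946,
    gc15_centre_zero 23031 zero_23031, gc15_centre_zero 28285 zero_28285,
    gc15_centre_zero 30622 zero_30622, gc15_centre_zero 31731 zero_31731,
    gc15_centre_zero 31928 zero_31928, gc15_centre_zero 32117 zero_32117,
    gc15_centre_zero 32214 zero_32214, gc15_centre_zero 32284 zero_32284,
    gc15_centre_zero 32753 zero_32753, gc15_centre_zero 32754 zero_32754]

/-- **THE EQUALITY LOCUS OF (HCOV) ON `K₆` — THE ZERO SIDE.**  On every edge set `M` of `K₆` in one of the five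
classes, `Gc p ends15 0 1 2 5 4 = 0` at every weight vector `p` supported on `M` (`p_e = 0` off `M`). -/
theorem gc15_zero_of_face (M : ℕ) (hM : M < 32768) (hr : FiveClass15 M = true) (p : Fin 15 → R)
    (hp₀ : ∀ e : Fin 15, M.testBit e = false → p e = 0) : Gc p ends15 0 1 2 5 4 = 0 := by
  obtain ⟨j, hj⟩ := coverZero M hM hr
  refine gc15_zero_of_centre (MX j) (gc_centre_MX j) p fun e he => hp₀ e ?_
  rcases Bool.eq_false_or_eq_true (M.testBit e) with h | h
  · rw [hj e h] at he
    exact absurd he (by decide)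
  · exact h

/-- **THE EQUALITY LOCUS OF (HCOV) ON `K₆` — THE POSITIVE SIDE.**  On every edge set `M` of `K₆` outside the
five classes, `Gc p ends15 0 1 2 5 4` is STRICTLY positive at every weight vector `p` interior on `M`
(`0 < p_e < 1` on the edges of `M`, `p_e = 0` off `M`): (HCOV) is strict in the interior of every
non-degenerate six-vertex face. -/
theorem gc15_pos_of_face (M : ℕ) (hM : M < 32768) (hr : FiveClass15 M = false) (p : Fin 15 → R)
    (hp₁ : ∀ e : Fin 15, M.testBit e = true → 0 < p e ∧ p e < 1)
    (hp₀ : ∀ e : Fin 15, M.testBit e = false → p e = 0) :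
    0 < Gc p ends15 0 1 2 5 4 := by
  obtain ⟨i, hi⟩ := coverPos M hM hr
  exact gc15_pos_of_witness M (decode15 (NW i)) (fun e he => hi e (supp_WW i e he)) (witness_lt i) p hp₁ hp₀

/-- **The crux functional is strictly positive on the open cube of `K₆`**: (HCOV) is strict on the complete
six-vertex graph for every interior weight vector. -/
theorem gc15_pos (p : Fin 15 → R) (hp : ∀ i, 0 < p i ∧ p i < 1) : 0 < Gc p ends15 0 1 2 5 4 :=
  gc15_pos_of_face 32767 (by norm_num) fiveClass15_full p (fun e _ => hp e)
    (fun e he => by exfalso; revert he; revert e; decide)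

/-- **THEOREM 31, FIRST «IFF»**: `Gc > 0` at every weight vector interior on `M` ⟺ `K₆(M)` is in none of the
five classes. -/
theorem gc15_pos_iff (M : ℕ) (hM : M < 32768) :
    (∀ p : Fin 15 → R, (∀ e : Fin 15, M.testBit e = true → 0 < p e ∧ p e < 1) →
      (∀ e : Fin 15, M.testBit e = false → p e = 0) → 0 < Gc p ends15 0 1 2 5 4) ↔
      FiveClass15 M = false := by
  constructor
  · intro h
    rcases Bool.eq_false_or_eq_true (FiveClass15 M) with hr | hr
    · exfalso
      have hpos := h (centre (R := R) M) (fun e he => centre_on_pos he) (fun e he => centre_off he)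
      have hzero := gc15_zero_of_face M hM hr (centre (R := R) M) (fun e he => centre_off he)
      rw [hzero] at hpos
      exact lt_irrefl _ hpos
    · exact hr
  · intro hr p hp₁ hp₀
    exact gc15_pos_of_face M hM hr p hp₁ hp₀

/-- **THEOREM 31, SECOND «IFF»**: `Gc = 0` at every admissible weight vector supported on `M` ⟺ `K₆(M)` is in
one of the five classes. -/
theorem gc15_zero_iff (M : ℕ) (hM : M < 32768) :
    (∀ p : Fin 15 → R, (∀ e : Fin 15, 0 ≤ p e ∧ p e ≤ 1) →
      (∀ e : Fin 15, M.testBit e = false → p e = 0) → Gc p ends15 0 1 2 5 4 = 0) ↔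
      FiveClass15 M = true := by
  constructor
  · intro h
    rcases Bool.eq_false_or_eq_true (FiveClass15 M) with hr | hr
    · exact hr
    · exfalso
      have hpos := gc15_pos_of_face M hM hr (centre (R := R) M)
        (fun e he => centre_on_pos he) (fun e he => centre_off he)
      have hzero := h (centre (R := R) M) (centre_01 M) (fun e he => centre_off he)
      rw [hzero] at hpos
      exact lt_irrefl _ hpos
  · intro hr p _ hp₀
    exact gc15_zero_of_face M hM hr p hp₀

end Theorem31

end Locus

end Deg5

end Summit.Ventures.PercRepro2
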